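import Summits.MatrixMultiplication.OmegaCensus.STPPKernelListerLeaf
import Summits.MatrixMultiplication.OmegaCensus.STPPKernelListerScanSoundH

/-!
# ω-census (abelian STPP census): kernel lister — assembly kit: ordering a pattern into list order, permutation-invariance of badness, row covers (kernel)

HONEST FRAMING (pub-omega census; verbatim): lottery ticket; floor = certified bounds/negative ranges.
Census STRUCTURE (seat pub-omega-stpp-2 gen 29, 2026-08-29), family (b2).  Nothing here is progress on `ω`.

Generic glue between an ARBITRARY pattern and the lister's list order: (1) every list whose elements lie in `R` has a permutation that is a count-vector
extension of `R` (`exists_perm_ordExt`); (2) badness (`Bad`) is invariant under permutations of the blocks (`Bad.perm`); (3) the root computations of several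
first-block selections combine (`scanFirstC_or`), so the row files (one selection each) give `scanFirstC` for the union of their first-block lists.
-/

open Finset

namespace Summit.MatrixMultiplication.OmegaCensus.KLister

/-! ## (1) Ordering a sub-multiset of `R` in list order -/

/-- `replicate m r ++ E` extends `r :: R` if `E` extends `R`. [folklore] -/
theorem OrdExt.replicate_append {r : Shape} {R E : List Shape} (h : OrdExt R E) (m : ℕ) : OrdExt (r :: R) (List.replicate m r ++ E) := by
  induction m with
  | zero => simpa using OrdExt.skip h
  | succ m ih => rw [List.replicate_succ, List.cons_append]; exact OrdExt.take ih

/-- **Every list over `R` is, up to a permutation, a count-vector extension of `R`.** [folklore] -/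
theorem exists_perm_ordExt : ∀ (R E : List Shape), (∀ e ∈ E, e ∈ R) → ∃ E', E'.Perm E ∧ OrdExt R E' := by
  intro R
  induction R with
  | nil =>
    intro E hE
    cases E with
    | nil => exact ⟨[], List.Perm.refl _, OrdExt.nil⟩
    | cons e E => exact absurd (hE e List.mem_cons_self) (by simp)
  | cons r R ih =>
    intro E hE
    -- the blocks different from `r` lie in `R`
    have hrest : ∀ e ∈ E.filter (fun x => !(x == r)), e ∈ R := by
      intro e he
      rw [List.mem_filter] at he
      obtain ⟨he, hne⟩ := he
      have hne' : e ≠ r := by simpa using hne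
      rcases List.mem_cons.1 (hE e he) with h | h
      · exact absurd h hne'
      · exact h
    obtain ⟨E', hp, ho⟩ := ih _ hrest
    refine ⟨List.replicate (List.count r E) r ++ E', ?_, ho.replicate_append _⟩
    have h1 : ((E.filter (· == r)) ++ E.filter (fun x => !(x == r))).Perm E := List.filter_append_perm _ _
    rw [List.filter_beq] at h1
    exact ((List.Perm.refl _).append hp).trans h1

/-! ## (2) Badness is permutation-invariant -/

/-- `lmin` depends only on the set of members. [folklore] -/
theorem lmin_eq_of_mem_iff (seed : ℕ) {l l' : List ℕ} (h : ∀ x, x ∈ l ↔ x ∈ l') : lmin seed l = lmin seed l' := by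
  apply le_antisymm
  · rcases lmin_cases seed l' with h' | h'
    · rw [h']; exact lmin_le_seed _ _
    · exact lmin_le_mem _ _ _ ((h _).2 h')
  · rcases lmin_cases seed l with h' | h'
    · rw [h']; exact lmin_le_seed _ _
    · exact lmin_le_mem _ _ _ ((h _).1 h')

variable {H : Type*} [AddCommGroup H] {n : ℕ}

/-- **`Bad` is invariant under permutations of the blocks.** [folklore] -/
theorem Bad.perm {P Q : List Shape} (hQ : Bad n H Q) (h : P.Perm Q) : Bad n H P := by
  obtain ⟨hR, hb, hm⟩ := hQ
  have hv : sumVol P = sumVol Q := by rw [sumVol_eq_sum, sumVol_eq_sum]; exact (h.map svol).sum_eq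
  have hl : lmin (n + 1) (P.map minprod) = lmin (n + 1) (Q.map minprod) :=
    lmin_eq_of_mem_iff _ fun x => (h.map minprod).mem_iff
  exact ⟨hR.perm h, by rw [hv]; exact hb, by rw [hv, hl]; exact hm⟩

/-! ## (3) Combining first-block selections -/

/-- One chunk: the conjunction of two selections. [folklore] -/
theorem scanFirstS_or {dead : List (List Shape)} {sel₁ sel₂ : Shape → Bool} {rows : List ℕ} {kAfter : St → List Shape → Bool} :
    ∀ ss : List Shape, scanFirstS n dead sel₁ rows kAfter ss = true → scanFirstS n dead sel₂ rows kAfter ss = true →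
      scanFirstS n dead (fun s => sel₁ s || sel₂ s) rows kAfter ss = true := by
  intro ss
  induction ss with
  | nil => intro _ _; rfl
  | cons s ss ih =>
    intro h1 h2
    rw [scanFirstS, Bool.and_eq_true] at h1 h2 ⊢
    refine ⟨?_, ih h1.2 h2.2⟩
    have a1 := h1.1; have a2 := h2.1
    rw [Bool.or_eq_true] at a1 a2 ⊢
    cases hs1 : sel₁ s <;> cases hs2 : sel₂ s <;> simp_all

/-- **All chunks: the conjunction of two selections.** [folklore] -/
theorem scanFirstC_or {dead : List (List Shape)} {sel₁ sel₂ : Shape → Bool} :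
    ∀ L : List (List ℕ × List Shape), scanFirstC n dead sel₁ L = true → scanFirstC n dead sel₂ L = true →
      scanFirstC n dead (fun s => sel₁ s || sel₂ s) L = true := by
  intro L
  induction L with
  | nil => intro _ _; rfl
  | cons ch rest ih =>
    obtain ⟨rows, ss⟩ := ch
    intro h1 h2
    rw [scanFirstC, Bool.and_eq_true] at h1 h2 ⊢
    exact ⟨scanFirstS_or ss h1.1 h2.1, ih h1.2 h2.2⟩

end Summit.MatrixMultiplication.OmegaCensus.KLister
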